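import Summits.QuantumFields.YangMills.Theorems.UnitScaleTiltProp7KatoBootstrapMember
import Summits.QuantumFields.YangMills.Theorems.UnitScaleTiltProp7FlatGaugeProjectorTower
import Literature.MathematicalPhysics.QuantumFieldTheory.Balaban1983to89.B9Eq344CovariantHessianRowTower
import HarnessLib

/-!
# Route `UnitScaleTilt`, crux K1 «MinimiserStabilityRegPr» (stmt-QuantumFields-19200), EX face after S45 — (L3′b)-GRAD FILE **(G1-2): THE TWO-BACKGROUND
# GRADIENT COMPARISON IN DIVERGENCE FORM** — the covariant massive site equation `Δ^η_V u + q = D*_V f` at a background `V` IS the FLAT equation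
# `(Δ^η_1 + 1)u = D*_1 g + r` with `g := f − (D_V − D_1)u` and an explicit remainder `r := (D*_V − D*_1)(f − D_V u) + (u − q)`, and on a ball where
# `‖V(b) − 1‖ ≤ δ` and `V` has an η-scale ½-Hölder modulus `Θ`, the flat lemma's data letters obey `M_g ≤ M_f + 2√2·ℓδ·M_u`,
# `H_g ≤ H_f + 2√2·(ℓΘ·M_u + ℓδ·H_u)`, `sup‖r‖ ≤ 6√2·ℓδ·(M_f + G + 2√2·ℓδ·M_u) + M_u + M_q` (`ℓ = L^{K−n} = η⁻¹`; `ℓδ`, `ℓΘ` are the K-free `O(ε₀)` products)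
# — ★p1 g25 CHAIR WORD №5 (a) (2026-08-30 05:11Z) on ★★OWNER RULING №35-B («(G1-1..3) divergence-form covariant perturbation against the flat lemma»).

Cell `ym3-torus` (HUMAN RULING D-0037; rung R3 = SU(2) YM₃ on T³ — NOT d = 4, NOT infinite volume, NOT a mass gap, NOT Clay).  Width seat `ym3-torus-px12` (gen 15).
THEOREMS ONLY (0 `def`, 0 `sorry`, default heartbeats); `--supports stmt-QuantumFields-19200 --as helper`; count-neutral.

WHY.  The GRADIENT halves of the ten post-S45 print rows need an interior η-scale `W^{1,∞}` estimate at a CURVED background `U₀ ∈ RegPr`; its FLAT core with the torus transfer is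
w5 g14's ✓`Prop7FlatMemberLocalGradient.exists_localGradient_flat_member` (G1-0), for `covLapSite F n K c₀ 1 u + 1•u = DstarL2 F n K c₀ 1 g` with a local sup letter `M_u` and a local
½-Hölder letter `H_g`.  THIS FILE is the perturbation step (G1-2): OPERATOR ALGEBRA on lit `B11Eq103H1Complex.covDerivL2K`∕`covDivL2K` ((3.3)∕(3.8)) plus the fibre row
`‖Ad(P)w − w‖ ≤ 2√2·‖P − 1‖·‖w‖` (✓`PoincareLipschitzCovariantBridge.norm_adW_sub_self_le`): `D_V − D_1 = η⁻¹(Ad V − 1)∘shift` (print's «`B`» of w5's LOCATE-L3B-GRAD §3 (†)),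
`D*_V − D*_1 = η⁻¹Σ_μ(Ad V⁻¹ − 1)` at the backward bonds («`B*`»), and `Δ^η_V = Δ^η_1 + D*_1∘(D_V − D_1) + (D*_V − D*_1)∘D_V` EXACTLY.
WHAT IS PROVED (ns `…Theorems.Prop7TwoBackgroundGradientComparison`; member `F n K`, weight `c₀ > 0`, ANY background `V`).  §1 `one_le_periodsT3`, `norm_inv_eta`, the stencils
`equiv_DL2_apply`∕`equiv_DstarL2_apply` (rfl), ★`covLapSite_eq_flat_add`, ★★`flat_equation_of_covariant` (`Δ^η_V u + q = D*_V f` ⟹ the flat equation with `g`, `r`).  §2 fibre rows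
`norm_adBg_sub_self_le`, `norm_adBgInv_sub_self_le`, ★`norm_adBg_sub_adBg_le` (two bonds).  §3 pointwise rows for `B`, `B*`, `D_V` (`equiv_DL2_sub_DL2_one`, `equiv_DstarL2_sub_DstarL2_one`,
★`norm_DL2_sub_DL2_one_le`, ★`norm_DL2_sub_DL2_one_sub_le`, ★`norm_DstarL2_sub_DstarL2_one_le`, `norm_DL2_le`).  §4 ★★★`two_background_gradient_comparison` — THE PACKAGE (inputs on the
ball of radius `ρ + 1`, outputs on radius `ρ`; `G` = the η-gradient sup of `u`, `H_u` = its ½-Hölder letter, DISPLAYED).  §5 ★`gradient_absorption` (so (G1-3) is one `linarith`).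
HONEST SCOPE.  Algebra and triangle inequalities; the (★) modulus `Θ` and the sup row `δ` are HYPOTHESES (their inhabitants: ✓p761256 `hflat_cubeGauge`-class rows at the cube gauge and
px19 g12 ∕ w5 g14's (★) files); nothing of (G1-3), the ten print rows, `hT`, `hGF`, EX `stub_existenceMinimalOrbit` or the crux is proved here; the Yang–Mills mass gap is NOT proved.

References: T. Bałaban, CMP **99** (1985) 389–434 [Balaban1985BackgroundPropagators] ((3.3) p.391, (3.5) p.391, (3.8) p.392, (3.23) p.394, Thm 3.1 (3.43)–(3.44) p.398);
CMP **98** (1985) 17–51 [Balaban1985Averaging] ((18)–(20) p.21); CMP **96** (1984) 223–250 [Balaban1984PropagatorsII] ((1.9) p.226).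
-/

set_option autoImplicit false

noncomputable section
open scoped InnerProductSpace ComplexConjugate BigOperators Matrix.Norms.L2Operator

namespace Summit.QuantumFields.YangMills.Theorems.Prop7TwoBackgroundGradientComparison

open Literature.MathematicalPhysics.QuantumFieldTheory.Balaban1983to89
open Literature.MathematicalPhysics.QuantumFieldTheory.Balaban1983to89.T3ContinuumYM3Torus
open B4Sect5Torus (TSite tdist tdist_triangle tdist_symm)
open B9SectCLatticeCarrier (Bond bpos btgt shift unshift tdist_shift_le tdist_shift_le' tdist_unshift_le tdist_unshift_le' shift_unshift unshift_shift)
open B9Eq311L2Pairing (WL2)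
open B9Eq33CovDerivVector (covDeriv covDiv covDeriv_apply_dir covDiv_apply)
open B11Eq103H1Complex (SiteL2K BondL2K covDerivL2K covDivL2K equiv_covDerivL2K equiv_covDivL2K)
open T3SectALandauChart (eta eta_pos)
open B9Eq344CovariantHessianRowTower (tdist_shift_shift)
open Summit.QuantumFields.YangMills.Theorems.Prop7SectET3Transport (periodsT3 bgOfCfg isUnitaryBg_bgOfCfg)
open Summit.QuantumFields.YangMills.Theorems.Prop7SectET3HilbertLetters (W₂ adW adBg adBgInv DL2 DstarL2 covLapSite)
open Summit.QuantumFields.YangMills.Theorems.Prop7FlatGaugeProjectorTower (adBg_one_eq adBgInv_one_eq)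
open Summit.QuantumFields.YangMills.Theorems.PoincareLipschitzCovariantBridge (norm_adW_sub_self_le adW_mul norm_adW mem_unitary_coe_inv inv_eq_star_mul inv_eq_star_inv)
open Summit.QuantumFields.YangMills.Theorems.Prop7KatoBootstrapMember (norm_adBg_eq)
variable (F : T3Family) (n K : ℕ) (c₀ : ℝ) [Fact (0 < c₀)]
/-! ## §1 Letters, stencils, and the exact three-term split `Δ^η_V = Δ^η_1 + D*_1∘(D_V − D_1) + (D*_V − D*_1)∘D_V` -/
/-- Every period of the finest torus is `≥ 1` (`= 2L^{m+K}`). [cite: Balaban1985BackgroundPropagators, (3.1) p.390] -/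
theorem one_le_periodsT3 (i : Fin 3) : 1 ≤ periodsT3 F K i := by
  have h : periodsT3 F K i = 2 * F.L ^ (F.m + K) := by show 2 * (F.P K).L ^ ((F.P K).m + (F.P K).K - 0) = 2 * F.L ^ (F.m + K); rfl
  have hL : 1 ≤ F.L ^ (F.m + K) := Nat.one_le_pow _ _ (by have := F.hL.2; omega)
  omega

/-- `‖η⁻¹‖ = ℓ = L^{K−n}` for the complex spacing scalar of (3.3)∕(3.8). [cite: Balaban1985BackgroundPropagators, (3.1) p.390] -/
theorem norm_inv_eta : ‖((((eta F n K : ℝ) : ℂ))⁻¹)‖ = (F.L : ℝ) ^ (K - n) := by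
  rw [norm_inv, Complex.norm_real, Real.norm_of_nonneg (eta_pos F n K).le, eta, inv_pow, inv_inv]

/-- The stencil (3.3) read through `WL2.equiv`: `(D_V u)(y,μ) = η⁻¹•(Ad(V(y,μ)) u(y+e_μ) − u(y))`. [cite: Balaban1985BackgroundPropagators, (3.3) p.391] -/
theorem equiv_DL2_apply (V : GaugeField (F.P K) 0 (Matrix.specialUnitaryGroup (Fin 2) ℂ)) (u : SiteL2K ℂ 3 (periodsT3 F K) c₀ W₂)
    (y : TSite 3 (periodsT3 F K)) (μ : Fin 3) :
    WL2.equiv ℂ (fun _ : Bond 3 (periodsT3 F K) => c₀) W₂ (DL2 F n K c₀ V u) (y, μ) =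
      ((((eta F n K : ℝ) : ℂ))⁻¹) • (adBg F K V (y, μ) (WL2.equiv ℂ (fun _ : TSite 3 (periodsT3 F K) => c₀) W₂ u (shift μ y))
        - WL2.equiv ℂ (fun _ : TSite 3 (periodsT3 F K) => c₀) W₂ u y) := rfl

/-- The stencil (3.8) read through `WL2.equiv`: `(D*_V A)(y) = η⁻¹•Σ_μ (Ad(V(y−e_μ,μ))⁻¹ A(y−e_μ,μ) − A(y,μ))`. [cite: Balaban1985BackgroundPropagators, (3.8) p.392] -/
theorem equiv_DstarL2_apply (V : GaugeField (F.P K) 0 (Matrix.specialUnitaryGroup (Fin 2) ℂ)) (A : BondL2K ℂ 3 (periodsT3 F K) c₀ W₂)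
    (y : TSite 3 (periodsT3 F K)) :
    WL2.equiv ℂ (fun _ : TSite 3 (periodsT3 F K) => c₀) W₂ (DstarL2 F n K c₀ V A) y =
      ((((eta F n K : ℝ) : ℂ))⁻¹) • ∑ μ : Fin 3, (adBgInv F K V (unshift μ y, μ) (WL2.equiv ℂ (fun _ : Bond 3 (periodsT3 F K) => c₀) W₂ A (unshift μ y, μ))
        - WL2.equiv ℂ (fun _ : Bond 3 (periodsT3 F K) => c₀) W₂ A (y, μ)) := rfl

/-- `Δ^η_V = D*_V ∘ D_V` (the definition). [cite: Balaban1985BackgroundPropagators, (3.23) p.394] -/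
theorem covLapSite_apply (V : GaugeField (F.P K) 0 (Matrix.specialUnitaryGroup (Fin 2) ℂ)) (u : SiteL2K ℂ 3 (periodsT3 F K) c₀ W₂) :
    covLapSite F n K c₀ V u = DstarL2 F n K c₀ V (DL2 F n K c₀ V u) := rfl

/-- ★ **THE EXACT THREE-TERM SPLIT**: `Δ^η_V u = Δ^η_1 u + D*_1((D_V − D_1)u) + (D*_V − D*_1)(D_V u)` — operator algebra, no hypothesis on `V`.
[cite: Balaban1985BackgroundPropagators, (3.23) p.394, (3.3) p.391, (3.8) p.392] -/
theorem covLapSite_eq_flat_add (V : GaugeField (F.P K) 0 (Matrix.specialUnitaryGroup (Fin 2) ℂ)) (u : SiteL2K ℂ 3 (periodsT3 F K) c₀ W₂) :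
    covLapSite F n K c₀ V u =
      covLapSite F n K c₀ 1 u + DstarL2 F n K c₀ 1 (DL2 F n K c₀ V u - DL2 F n K c₀ 1 u)
        + (DstarL2 F n K c₀ V (DL2 F n K c₀ V u) - DstarL2 F n K c₀ 1 (DL2 F n K c₀ V u)) := by
  rw [covLapSite_apply, covLapSite_apply, map_sub]
  abel

/-- ★★ **THE COVARIANT MASSIVE EQUATION IS A FLAT DIVERGENCE-FORM EQUATION WITH A REMAINDER**: if `Δ^η_V u + q = D*_V f` then
`(Δ^η_1 + 1)u = D*_1 g + r` with `g := f − (D_V − D_1)u` and `r := (D*_V − D*_1)(f − D_V u) + (u − q)` — the hypothesis `hu` of (G1-0)'s flat lemma for the datum `g`, up to `r`.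
[cite: Balaban1985BackgroundPropagators, (3.23) p.394; Balaban1984PropagatorsII, (1.9) p.226] -/
theorem flat_equation_of_covariant (V : GaugeField (F.P K) 0 (Matrix.specialUnitaryGroup (Fin 2) ℂ))
    {u q : SiteL2K ℂ 3 (periodsT3 F K) c₀ W₂} {f : BondL2K ℂ 3 (periodsT3 F K) c₀ W₂}
    (h : covLapSite F n K c₀ V u + q = DstarL2 F n K c₀ V f) :
    covLapSite F n K c₀ 1 u + ((1 : ℝ) : ℂ) • u =
      DstarL2 F n K c₀ 1 (f - (DL2 F n K c₀ V u - DL2 F n K c₀ 1 u))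
        + ((DstarL2 F n K c₀ V (f - DL2 F n K c₀ V u) - DstarL2 F n K c₀ 1 (f - DL2 F n K c₀ V u)) + (((1 : ℝ) : ℂ) • u - q)) := by
  have e := covLapSite_eq_flat_add F n K c₀ V u
  have h' : covLapSite F n K c₀ 1 u =
      DstarL2 F n K c₀ V f - q - DstarL2 F n K c₀ 1 (DL2 F n K c₀ V u - DL2 F n K c₀ 1 u)
        - (DstarL2 F n K c₀ V (DL2 F n K c₀ V u) - DstarL2 F n K c₀ 1 (DL2 F n K c₀ V u)) := by
    rw [← h, e]; abel
  rw [h']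
  simp only [map_sub]
  abel
/-! ## §2 Fibre rows at the member: `Ad` of a bond variable near `1`, and across two bonds -/
/-- `‖Ad(V(b))w − w‖ ≤ 2√2·‖V(b) − 1‖·‖w‖` on the Frobenius fibre (✓`norm_adW_sub_self_le` at the member's unitary background). [cite: Balaban1985Averaging, (18)–(20) p.21] -/
theorem norm_adBg_sub_self_le (V : GaugeField (F.P K) 0 (Matrix.specialUnitaryGroup (Fin 2) ℂ)) (p : Bond 3 (periodsT3 F K)) (w : W₂) :
    ‖adBg F K V p w - w‖ ≤ 2 * Real.sqrt 2 * ‖((bgOfCfg F K V p : (Matrix (Fin 2) (Fin 2) ℂ)ˣ) : Matrix (Fin 2) (Fin 2) ℂ) - 1‖ * ‖w‖ :=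
  norm_adW_sub_self_le _ (isUnitaryBg_bgOfCfg F K V p) w

/-- `‖Ad(V(b))⁻¹w − w‖ ≤ 2√2·‖V(b) − 1‖·‖w‖` (the inverse transporter of (3.8); `‖V⁻¹ − 1‖ = ‖(V − 1)*‖ = ‖V − 1‖`). [cite: Balaban1985Averaging, (18)–(20) p.21] -/
theorem norm_adBgInv_sub_self_le (V : GaugeField (F.P K) 0 (Matrix.specialUnitaryGroup (Fin 2) ℂ)) (p : Bond 3 (periodsT3 F K)) (w : W₂) :
    ‖adBgInv F K V p w - w‖ ≤ 2 * Real.sqrt 2 * ‖((bgOfCfg F K V p : (Matrix (Fin 2) (Fin 2) ℂ)ˣ) : Matrix (Fin 2) (Fin 2) ℂ) - 1‖ * ‖w‖ := by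
  have hU := isUnitaryBg_bgOfCfg F K V p
  have h := norm_adW_sub_self_le (bgOfCfg F K V p)⁻¹ (inv_eq_star_inv _ hU) w
  have hn : ‖((((bgOfCfg F K V p)⁻¹ : (Matrix (Fin 2) (Fin 2) ℂ)ˣ)) : Matrix (Fin 2) (Fin 2) ℂ) - 1‖
      = ‖((bgOfCfg F K V p : (Matrix (Fin 2) (Fin 2) ℂ)ˣ) : Matrix (Fin 2) (Fin 2) ℂ) - 1‖ := by
    rw [hU]
    calc ‖star ((bgOfCfg F K V p : (Matrix (Fin 2) (Fin 2) ℂ)ˣ) : Matrix (Fin 2) (Fin 2) ℂ) - 1‖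
        = ‖star (((bgOfCfg F K V p : (Matrix (Fin 2) (Fin 2) ℂ)ˣ) : Matrix (Fin 2) (Fin 2) ℂ) - 1)‖ := by rw [star_sub, star_one]
      _ = ‖((bgOfCfg F K V p : (Matrix (Fin 2) (Fin 2) ℂ)ˣ) : Matrix (Fin 2) (Fin 2) ℂ) - 1‖ := by
          rw [Matrix.star_eq_conjTranspose, Matrix.l2_opNorm_conjTranspose]
  rw [hn] at h
  exact h

/-- ★ **TWO BONDS**: `‖Ad(V(b))w − Ad(V(b′))w‖ ≤ 2√2·‖V(b) − V(b′)‖·‖w‖` (`Ad(Q)(Ad(Q⁻¹P)w − w)`, `Ad(Q)` an isometry, `‖Q⁻¹P − 1‖ ≤ ‖P − Q‖`) — the row through which the (★) modulus of the background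
becomes the modulus of `(D_V − D_1)u`. [cite: Balaban1985Averaging, (18)–(20) p.21] -/
theorem norm_adBg_sub_adBg_le (V : GaugeField (F.P K) 0 (Matrix.specialUnitaryGroup (Fin 2) ℂ)) (p p' : Bond 3 (periodsT3 F K)) (w : W₂) :
    ‖adBg F K V p w - adBg F K V p' w‖ ≤ 2 * Real.sqrt 2 *
      ‖((bgOfCfg F K V p : (Matrix (Fin 2) (Fin 2) ℂ)ˣ) : Matrix (Fin 2) (Fin 2) ℂ) - ((bgOfCfg F K V p' : (Matrix (Fin 2) (Fin 2) ℂ)ˣ) : Matrix (Fin 2) (Fin 2) ℂ)‖ * ‖w‖ := by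
  set P : (Matrix (Fin 2) (Fin 2) ℂ)ˣ := bgOfCfg F K V p with hPdef
  set Q : (Matrix (Fin 2) (Fin 2) ℂ)ˣ := bgOfCfg F K V p' with hQdef
  have hP : (((P⁻¹ : (Matrix (Fin 2) (Fin 2) ℂ)ˣ) : Matrix (Fin 2) (Fin 2) ℂ)) = star (P : Matrix (Fin 2) (Fin 2) ℂ) := isUnitaryBg_bgOfCfg F K V p
  have hQ : (((Q⁻¹ : (Matrix (Fin 2) (Fin 2) ℂ)ˣ) : Matrix (Fin 2) (Fin 2) ℂ)) = star (Q : Matrix (Fin 2) (Fin 2) ℂ) := isUnitaryBg_bgOfCfg F K V p'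
  have hQi : ((((Q⁻¹)⁻¹ : (Matrix (Fin 2) (Fin 2) ℂ)ˣ)) : Matrix (Fin 2) (Fin 2) ℂ) = star (((Q⁻¹ : (Matrix (Fin 2) (Fin 2) ℂ)ˣ)) : Matrix (Fin 2) (Fin 2) ℂ) :=
    inv_eq_star_inv Q hQ
  have hid : adW P w - adW Q w = adW Q (adW (Q⁻¹ * P) w - w) := by
    rw [map_sub, ← adW_mul, ← mul_assoc, mul_inv_cancel, one_mul]
  have h1 : ‖adW Q (adW (Q⁻¹ * P) w - w)‖ = ‖adW (Q⁻¹ * P) w - w‖ := norm_adW Q hQ _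
  have h2 := norm_adW_sub_self_le (Q⁻¹ * P) (inv_eq_star_mul _ _ hQi hP) w
  have h3 : ‖(((Q⁻¹ * P : (Matrix (Fin 2) (Fin 2) ℂ)ˣ)) : Matrix (Fin 2) (Fin 2) ℂ) - 1‖ ≤ ‖(P : Matrix (Fin 2) (Fin 2) ℂ) - (Q : Matrix (Fin 2) (Fin 2) ℂ)‖ := by
    have e : (((Q⁻¹ * P : (Matrix (Fin 2) (Fin 2) ℂ)ˣ)) : Matrix (Fin 2) (Fin 2) ℂ) - 1
        = (((Q⁻¹ : (Matrix (Fin 2) (Fin 2) ℂ)ˣ)) : Matrix (Fin 2) (Fin 2) ℂ) * ((P : Matrix (Fin 2) (Fin 2) ℂ) - (Q : Matrix (Fin 2) (Fin 2) ℂ)) := by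
      rw [Units.val_mul, Matrix.mul_sub, Units.inv_mul]
    rw [e]
    calc ‖(((Q⁻¹ : (Matrix (Fin 2) (Fin 2) ℂ)ˣ)) : Matrix (Fin 2) (Fin 2) ℂ) * ((P : Matrix (Fin 2) (Fin 2) ℂ) - (Q : Matrix (Fin 2) (Fin 2) ℂ))‖
        ≤ ‖(((Q⁻¹ : (Matrix (Fin 2) (Fin 2) ℂ)ˣ)) : Matrix (Fin 2) (Fin 2) ℂ)‖ * ‖(P : Matrix (Fin 2) (Fin 2) ℂ) - (Q : Matrix (Fin 2) (Fin 2) ℂ)‖ := norm_mul_le _ _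
      _ = ‖(P : Matrix (Fin 2) (Fin 2) ℂ) - (Q : Matrix (Fin 2) (Fin 2) ℂ)‖ := by
          rw [CStarRing.norm_of_mem_unitary (mem_unitary_coe_inv Q hQ), one_mul]
  show ‖adW P w - adW Q w‖ ≤ 2 * Real.sqrt 2 * ‖(P : Matrix (Fin 2) (Fin 2) ℂ) - (Q : Matrix (Fin 2) (Fin 2) ℂ)‖ * ‖w‖
  rw [hid, h1]
  calc ‖adW (Q⁻¹ * P) w - w‖ ≤ 2 * Real.sqrt 2 * ‖(((Q⁻¹ * P : (Matrix (Fin 2) (Fin 2) ℂ)ˣ)) : Matrix (Fin 2) (Fin 2) ℂ) - 1‖ * ‖w‖ := h2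
    _ ≤ 2 * Real.sqrt 2 * ‖(P : Matrix (Fin 2) (Fin 2) ℂ) - (Q : Matrix (Fin 2) (Fin 2) ℂ)‖ * ‖w‖ := by
        have h0 : 0 ≤ 2 * Real.sqrt 2 := by positivity
        exact mul_le_mul_of_nonneg_right (mul_le_mul_of_nonneg_left h3 h0) (norm_nonneg _)
/-! ## §3 Pointwise rows for `B := D_V − D_1`, `B* := D*_V − D*_1` and `D_V` -/
/-- **THE STENCIL OF `B = D_V − D_1`**: `((D_V − D_1)u)(y,μ) = η⁻¹•(Ad(V(y,μ)) − 1)(u(y+e_μ))` — print's «`B = η⁻¹(Ad V − 1)∘shift`». [cite: Balaban1985BackgroundPropagators, (3.3) p.391] -/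
theorem equiv_DL2_sub_DL2_one (V : GaugeField (F.P K) 0 (Matrix.specialUnitaryGroup (Fin 2) ℂ)) (u : SiteL2K ℂ 3 (periodsT3 F K) c₀ W₂)
    (y : TSite 3 (periodsT3 F K)) (μ : Fin 3) :
    WL2.equiv ℂ (fun _ : Bond 3 (periodsT3 F K) => c₀) W₂ (DL2 F n K c₀ V u - DL2 F n K c₀ 1 u) (y, μ) =
      ((((eta F n K : ℝ) : ℂ))⁻¹) • (adBg F K V (y, μ) (WL2.equiv ℂ (fun _ : TSite 3 (periodsT3 F K) => c₀) W₂ u (shift μ y))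
        - WL2.equiv ℂ (fun _ : TSite 3 (periodsT3 F K) => c₀) W₂ u (shift μ y)) := by
  rw [WL2.equiv_sub, Pi.sub_apply, equiv_DL2_apply, equiv_DL2_apply, adBg_one_eq, LinearMap.id_apply, ← smul_sub]
  congr 1
  abel

/-- **THE STENCIL OF `B* = D*_V − D*_1`**: `((D*_V − D*_1)A)(y) = η⁻¹•Σ_μ (Ad(V(y−e_μ,μ))⁻¹ − 1)(A(y−e_μ,μ))`. [cite: Balaban1985BackgroundPropagators, (3.8) p.392] -/
theorem equiv_DstarL2_sub_DstarL2_one (V : GaugeField (F.P K) 0 (Matrix.specialUnitaryGroup (Fin 2) ℂ)) (A : BondL2K ℂ 3 (periodsT3 F K) c₀ W₂)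
    (y : TSite 3 (periodsT3 F K)) :
    WL2.equiv ℂ (fun _ : TSite 3 (periodsT3 F K) => c₀) W₂ (DstarL2 F n K c₀ V A - DstarL2 F n K c₀ 1 A) y =
      ((((eta F n K : ℝ) : ℂ))⁻¹) • ∑ μ : Fin 3, (adBgInv F K V (unshift μ y, μ) (WL2.equiv ℂ (fun _ : Bond 3 (periodsT3 F K) => c₀) W₂ A (unshift μ y, μ))
        - WL2.equiv ℂ (fun _ : Bond 3 (periodsT3 F K) => c₀) W₂ A (unshift μ y, μ)) := by
  rw [WL2.equiv_sub, Pi.sub_apply, equiv_DstarL2_apply, equiv_DstarL2_apply, adBgInv_one_eq, ← smul_sub, ← Finset.sum_sub_distrib]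
  congr 1
  refine Finset.sum_congr rfl fun μ _ => ?_
  rw [LinearMap.id_apply]
  abel
variable {F K c₀}

/-- ★ **`B` IS SMALL WHERE THE BACKGROUND IS NEAR `1`**: `‖((D_V − D_1)u)(y,μ)‖ ≤ ℓ·2√2·‖V(y,μ) − 1‖·‖u(y+e_μ)‖`. [cite: Balaban1985BackgroundPropagators, (3.3) p.391; Balaban1985Averaging, (19) p.21] -/
theorem norm_DL2_sub_DL2_one_le (V : GaugeField (F.P K) 0 (Matrix.specialUnitaryGroup (Fin 2) ℂ)) (u : SiteL2K ℂ 3 (periodsT3 F K) c₀ W₂)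
    (y : TSite 3 (periodsT3 F K)) (μ : Fin 3) :
    ‖WL2.equiv ℂ (fun _ : Bond 3 (periodsT3 F K) => c₀) W₂ (DL2 F n K c₀ V u - DL2 F n K c₀ 1 u) (y, μ)‖ ≤
      (F.L : ℝ) ^ (K - n) * (2 * Real.sqrt 2 * ‖((bgOfCfg F K V (y, μ) : (Matrix (Fin 2) (Fin 2) ℂ)ˣ) : Matrix (Fin 2) (Fin 2) ℂ) - 1‖
        * ‖WL2.equiv ℂ (fun _ : TSite 3 (periodsT3 F K) => c₀) W₂ u (shift μ y)‖) := by
  rw [equiv_DL2_sub_DL2_one, norm_smul, norm_inv_eta]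
  exact mul_le_mul_of_nonneg_left (norm_adBg_sub_self_le F K V (y, μ) _) (by positivity)

/-- ★ **THE MODULUS OF `Bu` ACROSS TWO BONDS OF ONE DIRECTION**: `‖(Bu)(y′,μ) − (Bu)(y,μ)‖ ≤ ℓ·2√2·(‖V(y′,μ) − V(y,μ)‖·‖u(y′+e_μ)‖ + ‖V(y,μ) − 1‖·‖u(y′+e_μ) − u(y+e_μ)‖)` — the background's modulus
times the size of `u` plus the background's distance to `1` times the modulus of `u`. [cite: Balaban1985BackgroundPropagators, (3.3) p.391, Thm 3.1 (3.43) p.398] -/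
theorem norm_DL2_sub_DL2_one_sub_le (V : GaugeField (F.P K) 0 (Matrix.specialUnitaryGroup (Fin 2) ℂ)) (u : SiteL2K ℂ 3 (periodsT3 F K) c₀ W₂)
    (y y' : TSite 3 (periodsT3 F K)) (μ : Fin 3) :
    ‖WL2.equiv ℂ (fun _ : Bond 3 (periodsT3 F K) => c₀) W₂ (DL2 F n K c₀ V u - DL2 F n K c₀ 1 u) (y', μ)
        - WL2.equiv ℂ (fun _ : Bond 3 (periodsT3 F K) => c₀) W₂ (DL2 F n K c₀ V u - DL2 F n K c₀ 1 u) (y, μ)‖ ≤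
      (F.L : ℝ) ^ (K - n) * (2 * Real.sqrt 2 *
        (‖((bgOfCfg F K V (y', μ) : (Matrix (Fin 2) (Fin 2) ℂ)ˣ) : Matrix (Fin 2) (Fin 2) ℂ) - ((bgOfCfg F K V (y, μ) : (Matrix (Fin 2) (Fin 2) ℂ)ˣ) : Matrix (Fin 2) (Fin 2) ℂ)‖
            * ‖WL2.equiv ℂ (fun _ : TSite 3 (periodsT3 F K) => c₀) W₂ u (shift μ y')‖
          + ‖((bgOfCfg F K V (y, μ) : (Matrix (Fin 2) (Fin 2) ℂ)ˣ) : Matrix (Fin 2) (Fin 2) ℂ) - 1‖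
            * ‖WL2.equiv ℂ (fun _ : TSite 3 (periodsT3 F K) => c₀) W₂ u (shift μ y') - WL2.equiv ℂ (fun _ : TSite 3 (periodsT3 F K) => c₀) W₂ u (shift μ y)‖)) := by
  set w' : W₂ := WL2.equiv ℂ (fun _ : TSite 3 (periodsT3 F K) => c₀) W₂ u (shift μ y') with hw'
  set w : W₂ := WL2.equiv ℂ (fun _ : TSite 3 (periodsT3 F K) => c₀) W₂ u (shift μ y) with hw
  rw [equiv_DL2_sub_DL2_one, equiv_DL2_sub_DL2_one, ← smul_sub, norm_smul, norm_inv_eta]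
  refine mul_le_mul_of_nonneg_left ?_ (by positivity)
  have hid : adBg F K V (y', μ) w' - w' - (adBg F K V (y, μ) w - w)
      = (adBg F K V (y', μ) w' - adBg F K V (y, μ) w') + (adBg F K V (y, μ) (w' - w) - (w' - w)) := by
    rw [map_sub]; abel
  rw [hid]
  calc ‖(adBg F K V (y', μ) w' - adBg F K V (y, μ) w') + (adBg F K V (y, μ) (w' - w) - (w' - w))‖
      ≤ ‖adBg F K V (y', μ) w' - adBg F K V (y, μ) w'‖ + ‖adBg F K V (y, μ) (w' - w) - (w' - w)‖ := norm_add_le _ _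
    _ ≤ 2 * Real.sqrt 2 * ‖((bgOfCfg F K V (y', μ) : (Matrix (Fin 2) (Fin 2) ℂ)ˣ) : Matrix (Fin 2) (Fin 2) ℂ)
            - ((bgOfCfg F K V (y, μ) : (Matrix (Fin 2) (Fin 2) ℂ)ˣ) : Matrix (Fin 2) (Fin 2) ℂ)‖ * ‖w'‖
        + 2 * Real.sqrt 2 * ‖((bgOfCfg F K V (y, μ) : (Matrix (Fin 2) (Fin 2) ℂ)ˣ) : Matrix (Fin 2) (Fin 2) ℂ) - 1‖ * ‖w' - w‖ :=
          add_le_add (norm_adBg_sub_adBg_le F K V _ _ w') (norm_adBg_sub_self_le F K V _ _)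
    _ = _ := by ring

/-- ★ **`B*` IS SMALL WHERE THE BACKGROUND IS NEAR `1`**: if `‖V(y−e_μ,μ) − 1‖ ≤ δ` for the three backward bonds at `y`, then
`‖((D*_V − D*_1)A)(y)‖ ≤ ℓ·2√2·δ·Σ_μ‖A(y−e_μ,μ)‖`. [cite: Balaban1985BackgroundPropagators, (3.8) p.392; Balaban1985Averaging, (19) p.21] -/
theorem norm_DstarL2_sub_DstarL2_one_le (V : GaugeField (F.P K) 0 (Matrix.specialUnitaryGroup (Fin 2) ℂ)) (A : BondL2K ℂ 3 (periodsT3 F K) c₀ W₂)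
    (y : TSite 3 (periodsT3 F K)) {δ : ℝ}
    (hδ : ∀ μ : Fin 3, ‖((bgOfCfg F K V (unshift μ y, μ) : (Matrix (Fin 2) (Fin 2) ℂ)ˣ) : Matrix (Fin 2) (Fin 2) ℂ) - 1‖ ≤ δ) :
    ‖WL2.equiv ℂ (fun _ : TSite 3 (periodsT3 F K) => c₀) W₂ (DstarL2 F n K c₀ V A - DstarL2 F n K c₀ 1 A) y‖ ≤
      (F.L : ℝ) ^ (K - n) * (2 * Real.sqrt 2 * δ * ∑ μ : Fin 3, ‖WL2.equiv ℂ (fun _ : Bond 3 (periodsT3 F K) => c₀) W₂ A (unshift μ y, μ)‖) := by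
  rw [equiv_DstarL2_sub_DstarL2_one, norm_smul, norm_inv_eta]
  refine mul_le_mul_of_nonneg_left ?_ (by positivity)
  rw [Finset.mul_sum]
  refine (norm_sum_le _ _).trans (Finset.sum_le_sum fun μ _ => ?_)
  have hδ0 : 0 ≤ δ := (norm_nonneg _).trans (hδ 0)
  calc ‖adBgInv F K V (unshift μ y, μ) (WL2.equiv ℂ (fun _ : Bond 3 (periodsT3 F K) => c₀) W₂ A (unshift μ y, μ))
          - WL2.equiv ℂ (fun _ : Bond 3 (periodsT3 F K) => c₀) W₂ A (unshift μ y, μ)‖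
      ≤ 2 * Real.sqrt 2 * ‖((bgOfCfg F K V (unshift μ y, μ) : (Matrix (Fin 2) (Fin 2) ℂ)ˣ) : Matrix (Fin 2) (Fin 2) ℂ) - 1‖
          * ‖WL2.equiv ℂ (fun _ : Bond 3 (periodsT3 F K) => c₀) W₂ A (unshift μ y, μ)‖ := norm_adBgInv_sub_self_le F K V _ _
    _ ≤ 2 * Real.sqrt 2 * δ * ‖WL2.equiv ℂ (fun _ : Bond 3 (periodsT3 F K) => c₀) W₂ A (unshift μ y, μ)‖ := by
        have h0 : 0 ≤ 2 * Real.sqrt 2 := by positivity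
        exact mul_le_mul_of_nonneg_right (mul_le_mul_of_nonneg_left (hδ μ) h0) (norm_nonneg _)

/-- `‖(D_V u)(y,μ)‖ ≤ ℓ·(‖u(y+e_μ) − u(y)‖ + 2√2·‖V(y,μ) − 1‖·‖u(y+e_μ)‖)` — the covariant η-gradient against the flat one. [cite: Balaban1985BackgroundPropagators, (3.3) p.391] -/
theorem norm_DL2_le (V : GaugeField (F.P K) 0 (Matrix.specialUnitaryGroup (Fin 2) ℂ)) (u : SiteL2K ℂ 3 (periodsT3 F K) c₀ W₂)
    (y : TSite 3 (periodsT3 F K)) (μ : Fin 3) :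
    ‖WL2.equiv ℂ (fun _ : Bond 3 (periodsT3 F K) => c₀) W₂ (DL2 F n K c₀ V u) (y, μ)‖ ≤
      (F.L : ℝ) ^ (K - n) * (‖WL2.equiv ℂ (fun _ : TSite 3 (periodsT3 F K) => c₀) W₂ u (shift μ y) - WL2.equiv ℂ (fun _ : TSite 3 (periodsT3 F K) => c₀) W₂ u y‖
        + 2 * Real.sqrt 2 * ‖((bgOfCfg F K V (y, μ) : (Matrix (Fin 2) (Fin 2) ℂ)ˣ) : Matrix (Fin 2) (Fin 2) ℂ) - 1‖
          * ‖WL2.equiv ℂ (fun _ : TSite 3 (periodsT3 F K) => c₀) W₂ u (shift μ y)‖) := by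
  set w' : W₂ := WL2.equiv ℂ (fun _ : TSite 3 (periodsT3 F K) => c₀) W₂ u (shift μ y) with hw'
  set w : W₂ := WL2.equiv ℂ (fun _ : TSite 3 (periodsT3 F K) => c₀) W₂ u y with hw
  rw [equiv_DL2_apply, norm_smul, norm_inv_eta]
  refine mul_le_mul_of_nonneg_left ?_ (by positivity)
  have hid : adBg F K V (y, μ) w' - w = (w' - w) + (adBg F K V (y, μ) w' - w') := by abel
  rw [hid]
  exact (norm_add_le _ _).trans (add_le_add le_rfl (norm_adBg_sub_self_le F K V _ _))
/-! ## §4 ★★★ The package: the flat lemma's letters for `g := f − (D_V − D_1)u` and the remainder `r`, on a ball -/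
/-- ★★★ **THE TWO-BACKGROUND GRADIENT COMPARISON IN DIVERGENCE FORM** ([Balaban1985BackgroundPropagators] Thm 3.1 at a curved background, the perturbation step).  Fix a member
`F n K`, weight `c₀`, a background `V`, a centre `x` and a radius `ρ` (the flat lemma ✓`exists_localGradient_flat_member` has `ρ = 4ℓ`, `ℓ = L^{K−n}`).  INPUT rows, on the ball of
radius `ρ + 1` where a shifted site is read: the sup letter `M_u` of `u`, its η-gradient sup letter `G` (`ℓ‖u(y+e_μ) − u(y)‖ ≤ G`), its ½-Hölder letter `H_u`, the datum's letters
`M_f`, `H_f`, the penalty's pointwise letter `M_q`, the background's SUP row `‖V(b) − 1‖ ≤ δ` and its (★) ½-HÖLDER row `‖V(y′,μ) − V(y,μ)‖ ≤ Θ·(tdist y y′∕ℓ)^{½}` (w5 g14's currency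
`C·ε₀·η·(tdist·η)^{½}`: `Θ := C·ε₀·η`, `tdist·η = tdist∕ℓ`), and the covariant massive equation `Δ^η_V u + q = D*_V f`.  OUTPUT: the FLAT equation `(Δ^η_1 + 1)u = D*_1 g + r` with
`g := f − (D_V − D_1)u`, `r := (D*_V − D*_1)(f − D_V u) + (u − q)`, and on the ball of radius `ρ`: `‖g(b)‖ ≤ M_f + 2√2(ℓδ)M_u`; `‖g(y′,μ) − g(y,μ)‖ ≤ (H_f + 2√2(ℓΘ·M_u + ℓδ·H_u))·(tdist∕ℓ)^{½}`
— EXACTLY the `hbf` letters of (G1-0) §2∕§3 —; `‖r(y)‖ ≤ 6√2(ℓδ)(M_f + G + 2√2(ℓδ)M_u) + M_u + M_q`.  At the cube gauge `ℓδ = O(ε₀·R)`, `ℓΘ = C·ε₀` are K-FREE (✓p761256), so `H_g = H_f + O(ε₀)(M_u + H_u)`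
and the remainder is `O(ε₀)·G + O(1)·(M_u + M_f + M_q)` — the absorption of §5 closes the gradient row in (G1-3). [cite: Balaban1985BackgroundPropagators, Thm 3.1 (3.43)–(3.44) p.398, (3.3) p.391, (3.8) p.392] -/
theorem two_background_gradient_comparison (V : GaugeField (F.P K) 0 (Matrix.specialUnitaryGroup (Fin 2) ℂ))
    (u q : SiteL2K ℂ 3 (periodsT3 F K) c₀ W₂) (f : BondL2K ℂ 3 (periodsT3 F K) c₀ W₂) (x : TSite 3 (periodsT3 F K)) (ρ : ℝ)
    {Mu G Hu Mf Hf Mq δ Θ : ℝ} (hδ0 : 0 ≤ δ) (hΘ0 : 0 ≤ Θ)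
    (h : covLapSite F n K c₀ V u + q = DstarL2 F n K c₀ V f)
    (hMu : ∀ y, tdist (periodsT3 F K) x y ≤ ρ + 1 → ‖WL2.equiv ℂ (fun _ : TSite 3 (periodsT3 F K) => c₀) W₂ u y‖ ≤ Mu)
    (hG : ∀ (y : TSite 3 (periodsT3 F K)) (μ : Fin 3), tdist (periodsT3 F K) x y ≤ ρ + 1 →
      (F.L : ℝ) ^ (K - n) * ‖WL2.equiv ℂ (fun _ : TSite 3 (periodsT3 F K) => c₀) W₂ u (shift μ y) - WL2.equiv ℂ (fun _ : TSite 3 (periodsT3 F K) => c₀) W₂ u y‖ ≤ G)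
    (hHu : ∀ y y' : TSite 3 (periodsT3 F K), tdist (periodsT3 F K) x y ≤ ρ + 1 → tdist (periodsT3 F K) x y' ≤ ρ + 1 →
      ‖WL2.equiv ℂ (fun _ : TSite 3 (periodsT3 F K) => c₀) W₂ u y' - WL2.equiv ℂ (fun _ : TSite 3 (periodsT3 F K) => c₀) W₂ u y‖
        ≤ Hu * (tdist (periodsT3 F K) y y' / ((F.L : ℝ) ^ (K - n))) ^ ((1 : ℝ) / 2))
    (hMf : ∀ (y : TSite 3 (periodsT3 F K)) (μ : Fin 3), tdist (periodsT3 F K) x y ≤ ρ + 1 → ‖WL2.equiv ℂ (fun _ : Bond 3 (periodsT3 F K) => c₀) W₂ f (y, μ)‖ ≤ Mf)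
    (hHf : ∀ (y y' : TSite 3 (periodsT3 F K)) (μ : Fin 3), tdist (periodsT3 F K) x y ≤ ρ → tdist (periodsT3 F K) x y' ≤ ρ →
      ‖WL2.equiv ℂ (fun _ : Bond 3 (periodsT3 F K) => c₀) W₂ f (y', μ) - WL2.equiv ℂ (fun _ : Bond 3 (periodsT3 F K) => c₀) W₂ f (y, μ)‖
        ≤ Hf * (tdist (periodsT3 F K) y y' / ((F.L : ℝ) ^ (K - n))) ^ ((1 : ℝ) / 2))
    (hMq : ∀ y, tdist (periodsT3 F K) x y ≤ ρ → ‖WL2.equiv ℂ (fun _ : TSite 3 (periodsT3 F K) => c₀) W₂ q y‖ ≤ Mq)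
    (hδ : ∀ (y : TSite 3 (periodsT3 F K)) (μ : Fin 3), tdist (periodsT3 F K) x y ≤ ρ + 1 →
      ‖((bgOfCfg F K V (y, μ) : (Matrix (Fin 2) (Fin 2) ℂ)ˣ) : Matrix (Fin 2) (Fin 2) ℂ) - 1‖ ≤ δ)
    (hΘ : ∀ (y y' : TSite 3 (periodsT3 F K)) (μ : Fin 3), tdist (periodsT3 F K) x y ≤ ρ → tdist (periodsT3 F K) x y' ≤ ρ →
      ‖((bgOfCfg F K V (y', μ) : (Matrix (Fin 2) (Fin 2) ℂ)ˣ) : Matrix (Fin 2) (Fin 2) ℂ) - ((bgOfCfg F K V (y, μ) : (Matrix (Fin 2) (Fin 2) ℂ)ˣ) : Matrix (Fin 2) (Fin 2) ℂ)‖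
        ≤ Θ * (tdist (periodsT3 F K) y y' / ((F.L : ℝ) ^ (K - n))) ^ ((1 : ℝ) / 2)) :
    covLapSite F n K c₀ 1 u + ((1 : ℝ) : ℂ) • u =
        DstarL2 F n K c₀ 1 (f - (DL2 F n K c₀ V u - DL2 F n K c₀ 1 u))
          + ((DstarL2 F n K c₀ V (f - DL2 F n K c₀ V u) - DstarL2 F n K c₀ 1 (f - DL2 F n K c₀ V u)) + (((1 : ℝ) : ℂ) • u - q)) ∧
    (∀ (y : TSite 3 (periodsT3 F K)) (μ : Fin 3), tdist (periodsT3 F K) x y ≤ ρ →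
      ‖WL2.equiv ℂ (fun _ : Bond 3 (periodsT3 F K) => c₀) W₂ (f - (DL2 F n K c₀ V u - DL2 F n K c₀ 1 u)) (y, μ)‖
        ≤ Mf + 2 * Real.sqrt 2 * ((F.L : ℝ) ^ (K - n) * δ) * Mu) ∧
    (∀ (y y' : TSite 3 (periodsT3 F K)) (μ : Fin 3), tdist (periodsT3 F K) x y ≤ ρ → tdist (periodsT3 F K) x y' ≤ ρ →
      ‖WL2.equiv ℂ (fun _ : Bond 3 (periodsT3 F K) => c₀) W₂ (f - (DL2 F n K c₀ V u - DL2 F n K c₀ 1 u)) (y', μ)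
          - WL2.equiv ℂ (fun _ : Bond 3 (periodsT3 F K) => c₀) W₂ (f - (DL2 F n K c₀ V u - DL2 F n K c₀ 1 u)) (y, μ)‖
        ≤ (Hf + 2 * Real.sqrt 2 * (((F.L : ℝ) ^ (K - n) * Θ) * Mu + ((F.L : ℝ) ^ (K - n) * δ) * Hu))
          * (tdist (periodsT3 F K) y y' / ((F.L : ℝ) ^ (K - n))) ^ ((1 : ℝ) / 2)) ∧
    (∀ y : TSite 3 (periodsT3 F K), tdist (periodsT3 F K) x y ≤ ρ →
      ‖WL2.equiv ℂ (fun _ : TSite 3 (periodsT3 F K) => c₀) W₂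
          ((DstarL2 F n K c₀ V (f - DL2 F n K c₀ V u) - DstarL2 F n K c₀ 1 (f - DL2 F n K c₀ V u)) + (((1 : ℝ) : ℂ) • u - q)) y‖
        ≤ 6 * Real.sqrt 2 * ((F.L : ℝ) ^ (K - n) * δ) * (Mf + G + 2 * Real.sqrt 2 * ((F.L : ℝ) ^ (K - n) * δ) * Mu) + Mu + Mq) := by
  have hP := one_le_periodsT3 F K
  have hℓ0 : (0 : ℝ) < (F.L : ℝ) ^ (K - n) := pow_pos (by have := F.hL.2; exact_mod_cast (by omega : 0 < F.L)) _
  have hs2 : (0 : ℝ) ≤ 2 * Real.sqrt 2 := by positivity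
  have hsh : ∀ (y : TSite 3 (periodsT3 F K)) (μ : Fin 3), tdist (periodsT3 F K) x y ≤ ρ → tdist (periodsT3 F K) x (shift μ y) ≤ ρ + 1 :=
    fun y μ hy => (tdist_triangle hP x y (shift μ y)).trans (add_le_add hy (tdist_shift_le hP μ y))
  have hush : ∀ (y : TSite 3 (periodsT3 F K)) (μ : Fin 3), tdist (periodsT3 F K) x y ≤ ρ → tdist (periodsT3 F K) x (unshift μ y) ≤ ρ + 1 := fun y μ hy =>
    (tdist_triangle hP x y (unshift μ y)).trans (add_le_add hy (tdist_unshift_le hP μ y))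
  have hρ : ∀ (y : TSite 3 (periodsT3 F K)), tdist (periodsT3 F K) x y ≤ ρ → tdist (periodsT3 F K) x y ≤ ρ + 1 := fun y hy => hy.trans (by linarith)
  have hE : ∀ (y : TSite 3 (periodsT3 F K)) (μ : Fin 3), tdist (periodsT3 F K) x y ≤ ρ →
      ‖WL2.equiv ℂ (fun _ : Bond 3 (periodsT3 F K) => c₀) W₂ (DL2 F n K c₀ V u - DL2 F n K c₀ 1 u) (y, μ)‖ ≤ 2 * Real.sqrt 2 * ((F.L : ℝ) ^ (K - n) * δ) * Mu := by
    intro y μ hy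
    calc _ ≤ (F.L : ℝ) ^ (K - n) * (2 * Real.sqrt 2 * ‖((bgOfCfg F K V (y, μ) : (Matrix (Fin 2) (Fin 2) ℂ)ˣ) : Matrix (Fin 2) (Fin 2) ℂ) - 1‖
          * ‖WL2.equiv ℂ (fun _ : TSite 3 (periodsT3 F K) => c₀) W₂ u (shift μ y)‖) := norm_DL2_sub_DL2_one_le n V u y μ
      _ ≤ (F.L : ℝ) ^ (K - n) * (2 * Real.sqrt 2 * δ * Mu) := by
          refine mul_le_mul_of_nonneg_left ?_ hℓ0.le
          exact mul_le_mul (mul_le_mul_of_nonneg_left (hδ y μ (hρ y hy)) hs2) (hMu _ (hsh y μ hy)) (norm_nonneg _) (by positivity)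
      _ = _ := by ring
  refine ⟨flat_equation_of_covariant F n K c₀ V h, ?_, ?_, ?_⟩
  · intro y μ hy
    rw [WL2.equiv_sub, Pi.sub_apply]
    exact (norm_sub_le _ _).trans (add_le_add (hMf y μ (hρ y hy)) (hE y μ hy))
  · intro y y' μ hy hy'
    set s : ℝ := (tdist (periodsT3 F K) y y' / ((F.L : ℝ) ^ (K - n))) ^ ((1 : ℝ) / 2) with hs
    have hs0 : 0 ≤ s := by rw [hs]; exact Real.rpow_nonneg (div_nonneg (B4Sect5Torus.tdist_nonneg _ _ _) hℓ0.le) _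
    have hg : ∀ z : Bond 3 (periodsT3 F K), WL2.equiv ℂ (fun _ : Bond 3 (periodsT3 F K) => c₀) W₂ (f - (DL2 F n K c₀ V u - DL2 F n K c₀ 1 u)) z
        = WL2.equiv ℂ (fun _ : Bond 3 (periodsT3 F K) => c₀) W₂ f z
          - WL2.equiv ℂ (fun _ : Bond 3 (periodsT3 F K) => c₀) W₂ (DL2 F n K c₀ V u - DL2 F n K c₀ 1 u) z := fun z => by
      rw [WL2.equiv_sub, Pi.sub_apply]
    have hid : ∀ a b c d : W₂, a - b - (c - d) = (a - c) - (b - d) := fun a b c d => by abel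
    rw [hg, hg, hid]
    refine (norm_sub_le _ _).trans ?_
    have h1 := hHf y y' μ hy hy'
    have h2 := norm_DL2_sub_DL2_one_sub_le n V u y y' μ
    have hu' : ‖WL2.equiv ℂ (fun _ : TSite 3 (periodsT3 F K) => c₀) W₂ u (shift μ y')‖ ≤ Mu := hMu _ (hsh y' μ hy')
    have hmod : ‖WL2.equiv ℂ (fun _ : TSite 3 (periodsT3 F K) => c₀) W₂ u (shift μ y') - WL2.equiv ℂ (fun _ : TSite 3 (periodsT3 F K) => c₀) W₂ u (shift μ y)‖ ≤ Hu * s := by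
      have := hHu (shift μ y) (shift μ y') (hsh y μ hy) (hsh y' μ hy')
      rwa [tdist_shift_shift hP] at this
    have hV := hΘ y y' μ hy hy'
    have hV1 := hδ y μ (hρ y hy)
    calc ‖WL2.equiv ℂ (fun _ : Bond 3 (periodsT3 F K) => c₀) W₂ f (y', μ) - WL2.equiv ℂ (fun _ : Bond 3 (periodsT3 F K) => c₀) W₂ f (y, μ)‖
          + ‖WL2.equiv ℂ (fun _ : Bond 3 (periodsT3 F K) => c₀) W₂ (DL2 F n K c₀ V u - DL2 F n K c₀ 1 u) (y', μ)
              - WL2.equiv ℂ (fun _ : Bond 3 (periodsT3 F K) => c₀) W₂ (DL2 F n K c₀ V u - DL2 F n K c₀ 1 u) (y, μ)‖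
        ≤ Hf * s + (F.L : ℝ) ^ (K - n) * (2 * Real.sqrt 2 * (Θ * s * Mu + δ * (Hu * s))) := by
          refine add_le_add h1 (h2.trans (mul_le_mul_of_nonneg_left (mul_le_mul_of_nonneg_left (add_le_add ?_ ?_) hs2) hℓ0.le))
          · exact mul_le_mul hV hu' (norm_nonneg _) (mul_nonneg hΘ0 hs0)
          · exact mul_le_mul hV1 hmod (norm_nonneg _) hδ0
      _ = (Hf + 2 * Real.sqrt 2 * (((F.L : ℝ) ^ (K - n) * Θ) * Mu + ((F.L : ℝ) ^ (K - n) * δ) * Hu)) * s := by ring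
  · intro y hy
    have hδ' : ∀ μ : Fin 3, ‖((bgOfCfg F K V (unshift μ y, μ) : (Matrix (Fin 2) (Fin 2) ℂ)ˣ) : Matrix (Fin 2) (Fin 2) ℂ) - 1‖ ≤ δ := fun μ => hδ _ μ (hush y μ hy)
    have hterm : ∀ μ : Fin 3, ‖WL2.equiv ℂ (fun _ : Bond 3 (periodsT3 F K) => c₀) W₂ (f - DL2 F n K c₀ V u) (unshift μ y, μ)‖
        ≤ Mf + (G + 2 * Real.sqrt 2 * ((F.L : ℝ) ^ (K - n) * δ) * Mu) := by
      intro μ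
      rw [WL2.equiv_sub, Pi.sub_apply]
      refine (norm_sub_le _ _).trans (add_le_add (hMf _ μ (hush y μ hy)) ?_)
      have h3 := norm_DL2_le n V u (unshift μ y) μ
      rw [shift_unshift] at h3
      refine h3.trans ?_
      rw [mul_add]
      refine add_le_add ?_ ?_
      · have := hG (unshift μ y) μ (hush y μ hy)
        rwa [shift_unshift] at this
      · calc (F.L : ℝ) ^ (K - n) * (2 * Real.sqrt 2 * ‖((bgOfCfg F K V (unshift μ y, μ) : (Matrix (Fin 2) (Fin 2) ℂ)ˣ) : Matrix (Fin 2) (Fin 2) ℂ) - 1‖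
              * ‖WL2.equiv ℂ (fun _ : TSite 3 (periodsT3 F K) => c₀) W₂ u y‖)
            ≤ (F.L : ℝ) ^ (K - n) * (2 * Real.sqrt 2 * δ * Mu) := by
              refine mul_le_mul_of_nonneg_left ?_ hℓ0.le
              exact mul_le_mul (mul_le_mul_of_nonneg_left (hδ' μ) hs2) (hMu y (hρ y hy)) (norm_nonneg _) (by positivity)
          _ = 2 * Real.sqrt 2 * ((F.L : ℝ) ^ (K - n) * δ) * Mu := by ring
    have hB : ‖WL2.equiv ℂ (fun _ : TSite 3 (periodsT3 F K) => c₀) W₂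
          (DstarL2 F n K c₀ V (f - DL2 F n K c₀ V u) - DstarL2 F n K c₀ 1 (f - DL2 F n K c₀ V u)) y‖
        ≤ 6 * Real.sqrt 2 * ((F.L : ℝ) ^ (K - n) * δ) * (Mf + G + 2 * Real.sqrt 2 * ((F.L : ℝ) ^ (K - n) * δ) * Mu) := by
      refine (norm_DstarL2_sub_DstarL2_one_le n V (f - DL2 F n K c₀ V u) y hδ').trans ?_
      calc (F.L : ℝ) ^ (K - n) * (2 * Real.sqrt 2 * δ * ∑ μ : Fin 3, ‖WL2.equiv ℂ (fun _ : Bond 3 (periodsT3 F K) => c₀) W₂ (f - DL2 F n K c₀ V u) (unshift μ y, μ)‖)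
          ≤ (F.L : ℝ) ^ (K - n) * (2 * Real.sqrt 2 * δ * ∑ _μ : Fin 3, (Mf + (G + 2 * Real.sqrt 2 * ((F.L : ℝ) ^ (K - n) * δ) * Mu))) := by
            refine mul_le_mul_of_nonneg_left (mul_le_mul_of_nonneg_left (Finset.sum_le_sum fun μ _ => hterm μ) (by positivity)) hℓ0.le
        _ = 6 * Real.sqrt 2 * ((F.L : ℝ) ^ (K - n) * δ) * (Mf + G + 2 * Real.sqrt 2 * ((F.L : ℝ) ^ (K - n) * δ) * Mu) := by
            rw [Finset.sum_const, Finset.card_univ, Fintype.card_fin]; ring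
    have hZ : ‖WL2.equiv ℂ (fun _ : TSite 3 (periodsT3 F K) => c₀) W₂ ((((1 : ℝ) : ℂ) • u - q)) y‖ ≤ Mu + Mq := by
      rw [WL2.equiv_sub, Pi.sub_apply, WL2.equiv_smul, Pi.smul_apply]
      refine (norm_sub_le _ _).trans (add_le_add ?_ (hMq y hy))
      rw [norm_smul, Complex.norm_real, norm_one, one_mul]
      exact hMu y (hρ y hy)
    rw [WL2.equiv_add, Pi.add_apply]
    calc _ ≤ ‖WL2.equiv ℂ (fun _ : TSite 3 (periodsT3 F K) => c₀) W₂
              (DstarL2 F n K c₀ V (f - DL2 F n K c₀ V u) - DstarL2 F n K c₀ 1 (f - DL2 F n K c₀ V u)) y‖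
            + ‖WL2.equiv ℂ (fun _ : TSite 3 (periodsT3 F K) => c₀) W₂ ((((1 : ℝ) : ℂ) • u - q)) y‖ := norm_add_le _ _
      _ ≤ 6 * Real.sqrt 2 * ((F.L : ℝ) ^ (K - n) * δ) * (Mf + G + 2 * Real.sqrt 2 * ((F.L : ℝ) ^ (K - n) * δ) * Mu) + (Mu + Mq) := add_le_add hB hZ
      _ = _ := by ring
/-! ## §5 ★ The ε₀-absorption inequality -/
/-- ★ **ABSORPTION**: if the flat gradient row gives `G ≤ Cg·(M + (H₀ + a·G))` with `Cg·a ≤ ½` (the `O(ε₀)` coefficient of `G` inside `H_g`∕the remainder) and `G ≥ 0`, then `G ≤ 2·Cg·(M + H₀)` — so the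
(G1-3) knit is one `linarith`. [folklore] [cite: Balaban1985BackgroundPropagators, Thm 3.1 (3.44) p.398] -/
theorem gradient_absorption {G Cg M H₀ a : ℝ} (hG0 : 0 ≤ G) (hG : G ≤ Cg * (M + (H₀ + a * G))) (ha : Cg * a ≤ 1 / 2) :
    G ≤ 2 * Cg * (M + H₀) := by
  nlinarith [mul_nonneg (sub_nonneg.2 ha) hG0]

end Summit.QuantumFields.YangMills.Theorems.Prop7TwoBackgroundGradientComparison

end
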